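import Mathlib
import Summits.NavierStokesRegularity.NavierStokesRegularity.Theorems.FilamentSkeletonRssKelvinGateSharpContinuation
import Summits.NavierStokesRegularity.NavierStokesRegularity.Theorems.FilamentSkeletonRssKelvinGateFreeKernel
import Summits.NavierStokesRegularity.NavierStokesRegularity.Theorems.FilamentSkeletonRssKelvinGateRotationDivFree
import Literature.Analysis.FluidPDE.HarmonicOfSmallStencil
import Literature.Analysis.FluidPDE.DistributionalPressurePoisson
import Literature.Analysis.FluidPDE.ClassicalSolutionCalculus

/-!
# Route `FilamentSkeletonRss` · crux `TransverseReduction1AG` (stmt-27853) — line `kelvin_gate_sharp`: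
# THE A-PRIORI BOUND AT THE FREE END OF THE RAY AND FOR SMALL BASES (`SharpApriori` at `U⁰ = 0`, every rate; openness)

Helper file (theorems only, `--as helper`).  HONEST FRAMING: linear bookkeeping for a HYPOTHETICAL filament-type rotating-self-similar
blow-up route (MODEL rung, negative side); nothing here bears on Navier–Stokes regularity; no stub is proved; `TransverseReduction1AG`
is neither proved nor refuted.

The estimate-form kill-first stub `EventualSharpApriori1AS` (p642427) asks for the uniform a-priori bound
`SharpApriori (3/2) B α₁ (t·U⁰)` along the WHOLE ray `t ∈ [0,1]` of a dressed base; its `t = 0` end is the FREE operator.  This file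
settles that end and its neighbourhood, in the exact class the bound is stated in (`W ∈ X♯_a` = `C²` with sharp weights, divergence
free; `Q ∈ C¹` BOUNDED — weaker than the `C³/C²` class of `…KelvinGateFreeKernel`, p615350):

* `free_sharp_unique` — **uniqueness for the free operator in the sharp class, every rate `α`**: two solutions `(W₁,Q₁)`, `(W₂,Q₂)` of
  `𝓛_(α,0) W + ∇Q = F` with `Wᵢ ∈ X♯_a` (`a ≥ 0`) divergence free and `Qᵢ ∈ C¹` bounded have `W₁ = W₂`.  Proof: the difference `(W,Q)`
  solves the homogeneous equation; `Q` is WEAKLY harmonic — against a test `θ`, `∫ Q Δθ = −∫⟨∇Q,∇θ⟩ = ∫⟨𝓛W, ∇θ⟩`, and `𝓛_(α,0)W` is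
  weakly divergence free: its first-order part `α𝓡W + ½W + ½DW[y]` is a `C¹` divergence-free field (`IsDivFree.rotField` + the transport
  identity `div(DW[y]) = D(div W)[y] + div W`), and `∫⟨ΔW, ∇θ⟩ = ∫⟨W, ∇Δθ⟩ = 0` (Green + `Δ∇ = ∇Δ`); so `Q` is harmonic (tree Weyl
  lemma `harmonicOnNhd_of_continuousOn_of_weaklyHarmonic`) and bounded, hence constant (Liouville); then `𝓛_(α,0)W = 0` and the velocity
  maximum principle (`eq_zero_of_lerayLin_zero_base_eq_zero`, p613961) gives `W = 0`;
* `sharpApriori_free` — **`SharpApriori a C α 0` for `1 < a < 2`, every `α`**, with the free gate's constant (gate + uniqueness);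
* `SharpApriori.perturb` — **the a-priori bound is OPEN in the base**: `SharpApriori a B α U`, `V ∈ C²` of weighted size `M`, `8BM ≤ 1`
  ⇒ `SharpApriori a (2B) α (U+V)` (absorb `DW[V]+DV[W] ∈ Y♯(4M‖W‖)`, geometric bootstrap on the radius);
* `sharpApriori_small_ray` — hence for `8CM ≤ 1` the bound `SharpApriori a (2C) α (tV)` holds for ALL `t ∈ [0,1]`: the estimate-form stub
  holds at every SMALL sharp dressed base, every rate (the perturbative regime; the `O(Γ)` column is the crux and is NOT here).
-/

set_option linter.dupNamespace false

noncomputable section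

namespace Summit.NavierStokesRegularity.NavierStokesRegularity.Theorems.KelvinGate

open Set Function Filter MeasureTheory
open Literature.Analysis.FluidPDE Literature.Analysis
open scoped InnerProductSpace RealInnerProductSpace Laplacian ContDiff Topology BigOperators

/-! ## The first-order part of the free linearisation is a `C¹` divergence-free field -/

/-- The transport part `y ↦ ½W(y) + ½DW(y)[y]` of a divergence-free `C²` field is divergence free:
`div(DW[y]) = D(div W)[y] + div W = 0`. -/
theorem isDivFree_transportPart {W : EuclideanSpace ℝ (Fin 3) → EuclideanSpace ℝ (Fin 3)} (hW : ContDiff ℝ 2 W)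
    (hdiv : VectorCalculus.IsDivFree W) :
    VectorCalculus.IsDivFree (fun y => (1/2:ℝ) • W y + (1/2:ℝ) • fderiv ℝ W y y) := by
  intro y
  set b := EuclideanSpace.basisFun (Fin 3) ℝ with hb
  have hWd : HasFDerivAt W (fderiv ℝ W y) y := (hW.differentiable (by norm_num) y).hasFDerivAt
  have hPd : HasFDerivAt (fderiv ℝ W) (fderiv ℝ (fderiv ℝ W) y) y :=
    ((hW.fderiv_right (m := 1) (by norm_num)).differentiable (by norm_num) y).hasFDerivAt
  have hTd : HasFDerivAt (fun z => (1/2:ℝ) • W z + (1/2:ℝ) • fderiv ℝ W z z)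
      ((1/2:ℝ) • fderiv ℝ W y + (1/2:ℝ) • ((fderiv ℝ W y).comp (ContinuousLinearMap.id ℝ _) +
        (fderiv ℝ (fderiv ℝ W) y).flip y)) y :=
    (hWd.const_smul (1/2:ℝ)).add ((hPd.clm_apply ((ContinuousLinearMap.id ℝ _).hasFDerivAt)).const_smul (1/2:ℝ))
  have symm2 : ∀ v w, fderiv ℝ (fderiv ℝ W) y v w = fderiv ℝ (fderiv ℝ W) y w v := fun v w =>
    ((hW.contDiffAt (x := y)).isSymmSndFDerivAt (by simp)).eq v w
  have F0 : ∑ k : Fin 3, ⟪b k, fderiv ℝ W y (b k)⟫_ℝ = 0 := by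
    rw [← divergence_eq_sum_inner_fderiv b W y]; exact hdiv y
  have F1 : ∑ k : Fin 3, ⟪b k, fderiv ℝ (fderiv ℝ W) y (b k) y⟫_ℝ = 0 := by
    simp only [symm2 (b _) y]
    have := IsDivFree.sum_inner_fderiv_fderiv_apply hW hdiv y y
    rw [← hb] at this
    exact this
  rw [divergence_eq_sum_inner_fderiv b, hTd.fderiv]
  simp only [_root_.add_apply, _root_.smul_apply, ContinuousLinearMap.comp_apply, ContinuousLinearMap.flip_apply,
    ContinuousLinearMap.coe_id', id, inner_add_right, real_inner_smul_right, Finset.sum_add_distrib, ← Finset.mul_sum,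
    F0, F1]
  ring

/-- The first-order part `T W := α(e₃ × W − DW[e₃ × y]) + ½W + ½DW[y]` of `𝓛_(α,0) W` is `C¹` for `W ∈ C²`. -/
theorem contDiff_one_firstOrderPart (α : ℝ) {W : EuclideanSpace ℝ (Fin 3) → EuclideanSpace ℝ (Fin 3)} (hW : ContDiff ℝ 2 W) :
    ContDiff ℝ 1 (fun y => α • (cross (EuclideanSpace.single 2 1) (W y) - fderiv ℝ W y (cross (EuclideanSpace.single 2 1) y)) +
      ((1/2:ℝ) • W y + (1/2:ℝ) • fderiv ℝ W y y)) := by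
  have hW1 : ContDiff ℝ 1 W := hW.of_le (by norm_num)
  have hDW : ContDiff ℝ 1 (fderiv ℝ W) := hW.fderiv_right (m := 1) le_rfl
  have hJ : ContDiff ℝ 1 (fun y : EuclideanSpace ℝ (Fin 3) => cross (EuclideanSpace.single 2 1) y) := by
    simp only [cross_single_two_eq_rotGenL]; exact rotGenL.contDiff
  have h1 : ContDiff ℝ 1 (fun y => cross (EuclideanSpace.single 2 1) (W y)) := by
    simp only [cross_single_two_eq_rotGenL]; exact rotGenL.contDiff.comp hW1
  have h2 : ContDiff ℝ 1 (fun y => fderiv ℝ W y (cross (EuclideanSpace.single 2 1) y)) := hDW.clm_apply hJ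
  have h3 : ContDiff ℝ 1 (fun y => fderiv ℝ W y y) := hDW.clm_apply contDiff_id
  exact ((h1.sub h2).const_smul α).add ((hW1.const_smul _).add (h3.const_smul _))

/-- … and divergence free when `W` is. -/
theorem isDivFree_firstOrderPart (α : ℝ) {W : EuclideanSpace ℝ (Fin 3) → EuclideanSpace ℝ (Fin 3)} (hW : ContDiff ℝ 2 W)
    (hdiv : VectorCalculus.IsDivFree W) :
    VectorCalculus.IsDivFree (fun y => α • (cross (EuclideanSpace.single 2 1) (W y) - fderiv ℝ W y (cross (EuclideanSpace.single 2 1) y)) +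
      ((1/2:ℝ) • W y + (1/2:ℝ) • fderiv ℝ W y y)) := by
  intro y
  have hW1 : ContDiff ℝ 1 W := hW.of_le (by norm_num)
  have hDW : ContDiff ℝ 1 (fderiv ℝ W) := hW.fderiv_right (m := 1) le_rfl
  have hJ : ContDiff ℝ 1 (fun y : EuclideanSpace ℝ (Fin 3) => cross (EuclideanSpace.single 2 1) y) := by
    simp only [cross_single_two_eq_rotGenL]; exact rotGenL.contDiff
  have hR : ContDiff ℝ 1 (fun y => cross (EuclideanSpace.single 2 1) (W y) - fderiv ℝ W y (cross (EuclideanSpace.single 2 1) y)) := by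
    refine ContDiff.sub ?_ (hDW.clm_apply hJ)
    simp only [cross_single_two_eq_rotGenL]; exact rotGenL.contDiff.comp hW1
  have hRα : ContDiff ℝ 1 (fun y => α • (cross (EuclideanSpace.single 2 1) (W y) -
      fderiv ℝ W y (cross (EuclideanSpace.single 2 1) y))) := hR.const_smul α
  have hT : ContDiff ℝ 1 (fun y => (1/2:ℝ) • W y + (1/2:ℝ) • fderiv ℝ W y y) :=
    (hW1.const_smul _).add ((hDW.clm_apply contDiff_id).const_smul _)
  have hRd : DifferentiableAt ℝ (fun y => cross (EuclideanSpace.single 2 1) (W y) -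
      fderiv ℝ W y (cross (EuclideanSpace.single 2 1) y)) y := hR.differentiable (by norm_num) y
  have hRαd : DifferentiableAt ℝ (fun y => α • (cross (EuclideanSpace.single 2 1) (W y) -
      fderiv ℝ W y (cross (EuclideanSpace.single 2 1) y))) y := hRα.differentiable (by norm_num) y
  have hTd : DifferentiableAt ℝ (fun y => (1/2:ℝ) • W y + (1/2:ℝ) • fderiv ℝ W y y) y := hT.differentiable (by norm_num) y
  have e1 := divergence_add_apply hRαd hTd
  have e2 := divergence_const_smul_apply hRd α
  rw [e1, e2, IsDivFree.rotField hW hdiv y, isDivFree_transportPart hW hdiv y]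
  simp

/-! ## `𝓛_(α,0) W` is weakly divergence free for sharp divergence-free `W` -/

/-- For a test function `θ`: `∇θ` is `C²` with compact support, and `Δθ` is a test function. -/
theorem test_gradient_laplacian {θ : EuclideanSpace ℝ (Fin 3) → ℝ}
    (hθ : FunctionSpaces.IsTestFunctionOn (⊤ : TopologicalSpace.Opens (EuclideanSpace ℝ (Fin 3))) θ) :
    ContDiff ℝ 2 (gradient θ) ∧ HasCompactSupport (gradient θ) ∧
      FunctionSpaces.IsTestFunctionOn (⊤ : TopologicalSpace.Opens (EuclideanSpace ℝ (Fin 3))) (Δ θ) := by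
  have hθs := hθ.contDiff
  have hθc : HasCompactSupport θ := hθ.hasCompactSupport
  have hθ3 : ContDiff ℝ 3 θ := hθs.of_le (WithTop.coe_le_coe.mpr (le_top : ((3 : ℕ) : ℕ∞) ≤ ⊤))
  refine ⟨?_, ?_, ⟨?_, ?_, fun _ _ => trivial⟩⟩
  · exact (InnerProductSpace.toDual ℝ (EuclideanSpace ℝ (Fin 3))).symm.contDiff.comp (hθ3.fderiv_right (m := 2) (by norm_num))
  · exact (hθc.fderiv (𝕜 := ℝ)).comp_left (g := (InnerProductSpace.toDual ℝ (EuclideanSpace ℝ (Fin 3))).symm) (map_zero _)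
  · exact contDiff_infty.2 fun n => contDiff_laplacian (n := n) (contDiff_infty.1 hθs (n + 2))
  · exact HasCompactSupport.intro hθc fun _ hy => laplacian_eq_zero_of_notMem_tsupport hy

/-- Pairing of the Laplacian of a sharp field against a test gradient vanishes: `∫⟨ΔW, ∇θ⟩ = ∫⟨W, ∇Δθ⟩ = 0`. -/
theorem integral_inner_laplacian_gradient_eq_zero {W : EuclideanSpace ℝ (Fin 3) → EuclideanSpace ℝ (Fin 3)}
    (hW2 : ContDiff ℝ 2 W) (hdiv : VectorCalculus.IsDivFree W) {θ : EuclideanSpace ℝ (Fin 3) → ℝ}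
    (hθ : FunctionSpaces.IsTestFunctionOn (⊤ : TopologicalSpace.Opens (EuclideanSpace ℝ (Fin 3))) θ) :
    ∫ y, ⟪(Δ W) y, gradient θ y⟫_ℝ = 0 := by
  obtain ⟨hg2, hgc, hΔθ⟩ := test_gradient_laplacian hθ
  have hθ3 : ContDiff ℝ 3 θ := hθ.contDiff.of_le (WithTop.coe_le_coe.mpr (le_top : ((3 : ℕ) : ℕ∞) ≤ ⊤))
  rw [integral_inner_laplacian_comm hW2 hg2 hgc]
  have e : ∀ y, ⟪W y, (Δ (gradient θ)) y⟫_ℝ = ⟪W y, gradient (Δ θ) y⟫_ℝ := fun y => by rw [laplacian_gradient hθ3 y]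
  simp_rw [e]
  exact VectorCalculus.IsDivFree.isWeaklyDivFree_holds hdiv (hW2.of_le (by norm_num)) (Δ θ) hΔθ

/-- `𝓛_(α,0) W = T W − ΔW` pointwise, `T` the first-order part. -/
theorem lerayLin_zero_base_eq_firstOrderPart_sub (α : ℝ) (W : EuclideanSpace ℝ (Fin 3) → EuclideanSpace ℝ (Fin 3))
    (y : EuclideanSpace ℝ (Fin 3)) :
    lerayLin α (fun _ => 0) W y =
      (α • (cross (EuclideanSpace.single 2 1) (W y) - fderiv ℝ W y (cross (EuclideanSpace.single 2 1) y)) +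
        ((1/2:ℝ) • W y + (1/2:ℝ) • fderiv ℝ W y y)) - (Δ W) y := by
  simp only [lerayLin, fderiv_fun_const, Pi.zero_apply, map_zero, add_zero, zero_apply]
  abel

/-- **`𝓛_(α,0) W` is weakly divergence free** for `W ∈ C²` divergence free: `∫⟨𝓛_(α,0)W, ∇θ⟩ = 0` for every test `θ`. -/
theorem integral_inner_lerayLin_zero_gradient (α : ℝ)
    {W : EuclideanSpace ℝ (Fin 3) → EuclideanSpace ℝ (Fin 3)} (hW2 : ContDiff ℝ 2 W) (hdiv : VectorCalculus.IsDivFree W)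
    {θ : EuclideanSpace ℝ (Fin 3) → ℝ} (hθ : FunctionSpaces.IsTestFunctionOn (⊤ : TopologicalSpace.Opens (EuclideanSpace ℝ (Fin 3))) θ) :
    ∫ y, ⟪lerayLin α (fun _ => 0) W y, gradient θ y⟫_ℝ = 0 := by
  obtain ⟨hg2, hgc, -⟩ := test_gradient_laplacian hθ
  have hT1 := contDiff_one_firstOrderPart α hW2
  have hTdiv := isDivFree_firstOrderPart α hW2 hdiv
  have hI_T := VectorCalculus.IsDivFree.isWeaklyDivFree_holds hTdiv hT1 θ hθ
  have hI_Δ := integral_inner_laplacian_gradient_eq_zero hW2 hdiv hθ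
  -- integrability (continuous × compactly supported)
  have hgcont : Continuous (gradient θ) := hg2.continuous
  have hsupp : ∀ G : EuclideanSpace ℝ (Fin 3) → EuclideanSpace ℝ (Fin 3), Continuous G →
      Integrable (fun y => ⟪G y, gradient θ y⟫_ℝ) (volume : Measure (EuclideanSpace ℝ (Fin 3))) := fun G hG =>
    (hG.inner hgcont).integrable_of_hasCompactSupport
      (hgc.mono fun x hx => by
        rw [Function.mem_support] at hx ⊢
        contrapose! hx
        rw [hx, inner_zero_right])
  have hΔc : Continuous (Δ W) := (contDiff_laplacian (n := 0) (by simpa using hW2)).continuous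
  have hsub := integral_sub (hsupp _ hT1.continuous) (hsupp _ hΔc)
  rw [hI_T, hI_Δ, sub_zero] at hsub
  rw [← hsub]
  refine integral_congr_ae (Eventually.of_forall fun y => ?_)
  simp only
  rw [lerayLin_zero_base_eq_firstOrderPart_sub α W y, inner_sub_left]

/-! ## Uniqueness for the free operator in the sharp class -/

/-- A sharp X-bounded field tends to `0` at infinity. -/
theorem XSharp.decay {a : ℝ} {W : EuclideanSpace ℝ (Fin 3) → EuclideanSpace ℝ (Fin 3)} {R : ℝ} (h : XSharp a W R) :
    ∀ η : ℝ, 0 < η → ∃ L : ℝ, ∀ x, L ≤ ‖x‖ → ‖W x‖ ≤ η := by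
  intro η hη
  refine ⟨R / η, fun x hx => ?_⟩
  have h1 : (1 + ‖x‖) * ‖W x‖ ≤ R := (h.2 x).1
  have hx0 : 0 ≤ ‖x‖ := norm_nonneg x
  have hR : R ≤ η * ‖x‖ := by
    have := (div_le_iff₀ hη).mp hx
    linarith [this]
  by_contra hcon
  push Not at hcon
  have : (1 + ‖x‖) * η < (1 + ‖x‖) * ‖W x‖ := mul_lt_mul_of_pos_left hcon (by linarith)
  nlinarith

/-- **Trivial kernel of the free operator in the sharp class.**  `W ∈ C²` divergence free with `X♯`-type weights (any `a`), `Q ∈ C¹`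
bounded, `𝓛_(α,0) W + ∇Q = 0` pointwise ⇒ `W = 0` (and then `∇Q = 0`).  `Q` is weakly harmonic (`𝓛_(α,0)W` is weakly divergence
free), hence harmonic (Weyl), hence constant (Liouville); then the velocity maximum principle. -/
theorem eq_zero_of_free_sharp {a : ℝ} (α : ℝ) {W : EuclideanSpace ℝ (Fin 3) → EuclideanSpace ℝ (Fin 3)} {R : ℝ}
    {Q : EuclideanSpace ℝ (Fin 3) → ℝ} (hX : XSharp a W R) (hdiv : VectorCalculus.IsDivFree W) (hQ1 : ContDiff ℝ 1 Q)
    (hQb : ∃ M : ℝ, ∀ y, |Q y| ≤ M) (heq : ∀ y, lerayLin α (fun _ => 0) W y + gradient Q y = 0) :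
    W = 0 ∧ ∀ y, gradient Q y = 0 := by
  have hW2 : ContDiff ℝ 2 W := hX.1
  have hgrad : ∀ y, gradient Q y = -lerayLin α (fun _ => 0) W y := fun y => eq_neg_of_add_eq_zero_right (heq y)
  -- `Q` is weakly harmonic
  have hweak : ∀ φ : EuclideanSpace ℝ (Fin 3) → ℝ, ContDiff ℝ (⊤ : ℕ∞) φ → HasCompactSupport φ → tsupport φ ⊆ univ →
      ∫ x, Q x * (Δ φ) x = 0 := by
    intro φ hφs hφc _
    have hφtest : FunctionSpaces.IsTestFunctionOn (⊤ : TopologicalSpace.Opens (EuclideanSpace ℝ (Fin 3))) φ :=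
      ⟨hφs, hφc, fun _ _ => trivial⟩
    obtain ⟨hg2, hgc, -⟩ := test_gradient_laplacian hφtest
    have hφ2 : ContDiff ℝ 2 φ := hφs.of_le (WithTop.coe_le_coe.mpr (le_top : ((2 : ℕ) : ℕ∞) ≤ ⊤))
    -- `∫ Q div(∇φ) + ∫⟨∇φ, ∇Q⟩ = 0`
    have hIBP := integral_mul_divergence_add_eq_zero_right hQ1 (hg2.of_le (by norm_num)) hgc
    have hdivgrad : ∀ x, VectorCalculus.divergence (gradient φ) x = (Δ φ) x := fun x => divergence_gradient hφ2 x
    simp only [hdivgrad] at hIBP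
    -- `∫⟨∇φ, ∇Q⟩ = −∫⟨𝓛W, ∇φ⟩ = 0`
    have hpair : ∫ x, ⟪gradient φ x, gradient Q x⟫_ℝ = 0 := by
      have e : ∀ x, ⟪gradient φ x, gradient Q x⟫_ℝ = -⟪lerayLin α (fun _ => 0) W x, gradient φ x⟫_ℝ := fun x => by
        rw [hgrad x, inner_neg_right, real_inner_comm (lerayLin α (fun _ => 0) W x)]
      simp_rw [e]
      rw [integral_neg, integral_inner_lerayLin_zero_gradient α hW2 hdiv hφtest, neg_zero]
    linarith
  have hharm := harmonicOnNhd_of_continuousOn_of_weaklyHarmonic isOpen_univ hQ1.continuous.continuousOn hweak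
  have hconst : ∀ x y, Q x = Q y := isConst_of_harmonic_bounded hharm hQb
  have hQc : Q = fun _ => Q 0 := funext fun y => hconst y 0
  have hgrad0 : ∀ y, gradient Q y = 0 := by
    intro y; rw [hQc]; exact gradient_fun_const y (Q 0)
  have hvel : ∀ y, lerayLin α (fun _ => 0) W y = 0 := fun y => by
    have := heq y; rwa [hgrad0 y, add_zero] at this
  exact ⟨eq_zero_of_lerayLin_zero_base_eq_zero α hW2 hX.decay hvel, hgrad0⟩

/-- **UNIQUENESS FOR THE FREE OPERATOR IN THE SHARP CLASS, every rate `α`.**  Two solutions `(W₁,Q₁)`, `(W₂,Q₂)` of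
`𝓛_(α,0) W + ∇Q = F` — `Wᵢ` sharp X-bounded (any weight `a`) and divergence free, `Qᵢ ∈ C¹` bounded — have `W₁ = W₂`. -/
theorem free_sharp_unique {a : ℝ} (α : ℝ) {W₁ W₂ F : EuclideanSpace ℝ (Fin 3) → EuclideanSpace ℝ (Fin 3)}
    {Q₁ Q₂ : EuclideanSpace ℝ (Fin 3) → ℝ} {R₁ R₂ M₁ M₂ : ℝ}
    (hW₁ : XSharp a W₁ R₁) (hW₂ : XSharp a W₂ R₂) (hd₁ : VectorCalculus.IsDivFree W₁) (hd₂ : VectorCalculus.IsDivFree W₂)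
    (hQ₁ : ContDiff ℝ 1 Q₁) (hQ₂ : ContDiff ℝ 1 Q₂) (hM₁ : ∀ y, |Q₁ y| ≤ M₁) (hM₂ : ∀ y, |Q₂ y| ≤ M₂)
    (h₁ : ∀ y, lerayLin α (fun _ => 0) W₁ y + gradient Q₁ y = F y)
    (h₂ : ∀ y, lerayLin α (fun _ => 0) W₂ y + gradient Q₂ y = F y) :
    W₁ = W₂ := by
  have hX : XSharp a (fun y => W₁ y - W₂ y) (R₁ + R₂) := hW₁.sub hW₂
  have hdiff₁ : Differentiable ℝ W₁ := hW₁.1.differentiable (by norm_num)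
  have hdiff₂ : Differentiable ℝ W₂ := hW₂.1.differentiable (by norm_num)
  have hdiv : VectorCalculus.IsDivFree (fun y => W₁ y - W₂ y) := isDivFree_fun_sub hd₁ hd₂ hdiff₁ hdiff₂
  have hQ : ContDiff ℝ 1 (fun y => Q₁ y - Q₂ y) := hQ₁.sub hQ₂
  have hQb : ∃ Mq, ∀ y, |Q₁ y - Q₂ y| ≤ Mq :=
    ⟨M₁ + M₂, fun y => (abs_sub _ _).trans (add_le_add (hM₁ y) (hM₂ y))⟩
  have heq : ∀ y, lerayLin α (fun _ => 0) (fun z => W₁ z - W₂ z) y + gradient (fun z => Q₁ z - Q₂ z) y = 0 := by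
    intro y
    rw [lerayLin_fun_sub α (fun _ => 0) hW₁.1.contDiffAt hW₂.1.contDiffAt,
      gradient_fun_sub' ((hQ₁.differentiable (by norm_num)) y) ((hQ₂.differentiable (by norm_num)) y)]
    have e : lerayLin α (fun _ => 0) W₁ y - lerayLin α (fun _ => 0) W₂ y + (gradient Q₁ y - gradient Q₂ y) =
        (lerayLin α (fun _ => 0) W₁ y + gradient Q₁ y) - (lerayLin α (fun _ => 0) W₂ y + gradient Q₂ y) := by abel
    rw [e, h₁ y, h₂ y, sub_self]
  have h0 := (eq_zero_of_free_sharp α hX hdiv hQ hQb heq).1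
  funext y
  have := congrFun h0 y
  simp only [Pi.zero_apply] at this
  exact sub_eq_zero.mp this

/-! ## The a-priori bound at the free base, and its openness -/

/-- **`SharpApriori` AT THE FREE BASE, every rate** (`1 < a < 2`): with the free gate's constant `C = C(a)`, every sharp solution
`(W, Q)` of `𝓛_(α,0) W + ∇Q = F`, `F ∈ Y♯_a(R)`, has `W ∈ X♯_a(C R)` — the `t = 0` end of the estimate-form stub
`EventualSharpApriori1AS`.  (The free gate produces a solution in the class; by `free_sharp_unique` it is the given one.) -/
theorem sharpApriori_free {a : ℝ} (ha1 : 1 < a) (ha2 : a < 2) :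
    ∃ C : ℝ, 0 ≤ C ∧ ∀ α : ℝ, SharpApriori a C α (fun _ => 0) := by
  obtain ⟨C, hC0, hfree⟩ := sharpGateSpec_free ha1 ha2
  refine ⟨C, hC0, fun α => ?_⟩
  intro W Q F R hW hdiv hQ hQb hF heq
  obtain ⟨R', hW'⟩ := hW
  obtain ⟨Mq, hMq⟩ := hQb
  obtain ⟨hX, hdivK, hQ1, hQbK, heqK⟩ := (hfree α).1 F R hF
  have hWK := free_sharp_unique α hW' hX hdiv hdivK hQ hQ1 hMq hQbK heq heqK
  rw [hWK]; exact hX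

/-- Sharp X-bounds pass to the limit of the radii. -/
theorem XSharp.of_forall_le {a : ℝ} {W : EuclideanSpace ℝ (Fin 3) → EuclideanSpace ℝ (Fin 3)} {r : ℕ → ℝ} {L : ℝ}
    (h : ∀ n, XSharp a W (r n)) (hr : Tendsto r atTop (𝓝 L)) : XSharp a W L := by
  refine ⟨(h 0).1, fun y => ⟨?_, ?_, ?_⟩⟩
  · exact ge_of_tendsto' hr fun n => ((h n).2 y).1
  · exact ge_of_tendsto' hr fun n => ((h n).2 y).2.1
  · exact ge_of_tendsto' hr fun n => ((h n).2 y).2.2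

/-- **The a-priori bound is OPEN in the base.**  `SharpApriori a B α U` (`a ≤ 2`, `U` differentiable), a `C²` increment `V` of weighted
size `M` with `8BM ≤ 1` ⇒ `SharpApriori a (2B) α (U + V)`.  (A solution at `U + V` solves at `U` with datum `F − (DW[V] + DV[W]) ∈
Y♯(R + 4M ρ)` when `W ∈ X♯(ρ)`; so `ρ ↦ B(R + 4Mρ)` improves any radius, and the radii `ρₙ → BR/(1 − 4BM) ≤ 2BR`.) -/
theorem SharpApriori.perturb {a B α M : ℝ} {U V : EuclideanSpace ℝ (Fin 3) → EuclideanSpace ℝ (Fin 3)}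
    (hB : SharpApriori a B α U) (hB0 : 0 ≤ B) (ha2 : a ≤ 2) (hU : Differentiable ℝ U) (hV : ContDiff ℝ 2 V)
    (hV0 : ∀ y, (1 + ‖y‖) * ‖V y‖ ≤ M) (hV1 : ∀ y, (1 + ‖y‖) ^ 2 * ‖fderiv ℝ V y‖ ≤ M)
    (hV2 : ∀ y, (1 + ‖y‖) ^ 3 * ‖fderiv ℝ (fderiv ℝ V) y‖ ≤ M) (hBM : 8 * B * M ≤ 1) :
    SharpApriori a (2 * B) α (fun z => U z + V z) := by
  intro W Q F R hW hdiv hQ hQb hF heq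
  obtain ⟨R', hW'⟩ := hW
  have hM : 0 ≤ M := le_trans (by positivity) (hV0 0)
  have hR : 0 ≤ R := hF.nonneg
  have hVd : Differentiable ℝ V := hV.differentiable (by norm_num)
  -- the equation at the base `U`
  have heqU : ∀ y, lerayLin α U W y + gradient Q y = F y - (fderiv ℝ W y (V y) + fderiv ℝ V y (W y)) := by
    intro y
    have h := heq y
    rw [lerayLin_add_base α U V W y (hU y) (hVd y)] at h
    rw [← h]; abel
  -- one improvement step: `X♯(ρ) ⇒ X♯(B(R + 4Mρ))`
  have step : ∀ ρ, XSharp a W ρ → XSharp a W (B * (R + 4 * M * ρ)) := by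
    intro ρ hρ
    have hP : YSharp a (fun y => fderiv ℝ W y (V y) + fderiv ℝ V y (W y)) (4 * M * ρ) :=
      hρ.ySharp_perturbation ha2 hV hV0 hV1 hV2
    exact hB W Q _ _ ⟨ρ, hρ⟩ hdiv hQ hQb (hF.sub hP) heqU
  -- the radii `ρ₀ = R'`, `ρₙ₊₁ = B(R + 4Mρₙ)`
  set q : ℝ := 4 * B * M with hq
  have hq0 : 0 ≤ q := by positivity
  have hq1 : q ≤ 1 / 2 := by rw [hq]; linarith
  let ρ : ℕ → ℝ := fun n => Nat.rec R' (fun _ r => B * (R + 4 * M * r)) n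
  have hρ0 : ρ 0 = R' := rfl
  have hρs : ∀ n, ρ (n + 1) = B * (R + 4 * M * ρ n) := fun n => rfl
  have hXρ : ∀ n, XSharp a W (ρ n) := by
    intro n
    induction n with
    | zero => rw [hρ0]; exact hW'
    | succ n ih => rw [hρs]; exact step _ ih
  -- closed form: `ρₙ = qⁿ R' + BR (1 − qⁿ)/(1 − q)`; we only need the limit, via the affine contraction
  have hlim : Tendsto ρ atTop (𝓝 (B * R / (1 - q))) := by
    have h1q : 0 < 1 - q := by linarith
    set L : ℝ := B * R / (1 - q) with hL
    have hfix : B * (R + 4 * M * L) = L := by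
      rw [hL]; field_simp; ring
    -- `ρₙ − L = qⁿ (R' − L)`
    have hdiff : ∀ n, ρ n - L = q ^ n * (R' - L) := by
      intro n
      induction n with
      | zero => rw [hρ0]; ring
      | succ n ih =>
        rw [hρs, pow_succ]
        have : B * (R + 4 * M * ρ n) - L = q * (ρ n - L) := by
          rw [hq]; linear_combination hfix
        rw [this, ih]; ring
    have hgeom : Tendsto (fun n => q ^ n * (R' - L)) atTop (𝓝 (0 * (R' - L))) :=
      (tendsto_pow_atTop_nhds_zero_of_lt_one hq0 (by linarith)).mul_const _
    rw [zero_mul] at hgeom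
    have : ρ = fun n => L + q ^ n * (R' - L) := funext fun n => by rw [← hdiff n]; ring
    rw [this]
    have := hgeom.const_add L
    rwa [add_zero] at this
  have hXL : XSharp a W (B * R / (1 - q)) := XSharp.of_forall_le hXρ hlim
  refine hXL.mono ?_
  -- `BR/(1−q) ≤ 2BR` since `q ≤ 1/2`
  have h1q : 0 < 1 - q := by linarith
  rw [div_le_iff₀ h1q]
  have h3 : 0 ≤ B * R * (1 - 2 * q) := mul_nonneg (mul_nonneg hB0 hR) (by linarith)
  nlinarith [h3]

/-- **The estimate-form stub holds at every SMALL sharp base, every rate.**  For `1 < a < 2` there is `C = C(a) ≥ 0` such that for every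
rate `α` and every `C²` base `V` of weighted size `M` with `8CM ≤ 1`, the uniform a-priori bound `SharpApriori a (2C) α (tV)` holds for
ALL `t ∈ [0,1]` — i.e. the hypothesis of `sharp_gate_of_apriori` / the content of `EventualSharpApriori1AS` in the perturbative regime. -/
theorem sharpApriori_small_ray {a : ℝ} (ha1 : 1 < a) (ha2 : a < 2) :
    ∃ C : ℝ, 0 ≤ C ∧ ∀ (α M : ℝ) (V : EuclideanSpace ℝ (Fin 3) → EuclideanSpace ℝ (Fin 3)),
      ContDiff ℝ 2 V → (∀ y, (1 + ‖y‖) * ‖V y‖ ≤ M) → (∀ y, (1 + ‖y‖) ^ 2 * ‖fderiv ℝ V y‖ ≤ M) →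
      (∀ y, (1 + ‖y‖) ^ 3 * ‖fderiv ℝ (fderiv ℝ V) y‖ ≤ M) → 8 * C * M ≤ 1 →
      ∀ t ∈ Set.Icc (0:ℝ) 1, SharpApriori a (2 * C) α (fun z => t • V z) := by
  obtain ⟨C, hC0, hfree⟩ := sharpApriori_free ha1 ha2
  refine ⟨C, hC0, fun α M V hV hV0 hV1 hV2 hCM t ht => ?_⟩
  have hM : 0 ≤ M := le_trans (by positivity) (hV0 0)
  obtain ⟨hVc, hW0, hW1, hW2⟩ := baseIncrement_smul hV hV0 hV1 hV2 t
  have ht1 : |t| * M ≤ M := by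
    rw [abs_of_nonneg ht.1]
    calc t * M ≤ 1 * M := mul_le_mul_of_nonneg_right ht.2 hM
      _ = M := one_mul M
  have hCM' : 8 * C * (|t| * M) ≤ 1 := le_trans (mul_le_mul_of_nonneg_left ht1 (by positivity)) hCM
  have h := (hfree α).perturb hC0 ha2.le (differentiable_const _) hVc hW0 hW1 hW2 hCM'
  have e : (fun z => (fun _ => (0 : EuclideanSpace ℝ (Fin 3))) z + t • V z) = fun z => t • V z := by funext z; simp
  rwa [e] at h

end Summit.NavierStokesRegularity.NavierStokesRegularity.Theorems.KelvinGate

end
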